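import Mathlib.Algebra.Field.ZMod
import Mathlib.Algebra.Polynomial.FieldDivision
import Mathlib.LinearAlgebra.Matrix.Circulant
import Mathlib.LinearAlgebra.Matrix.Rank
import Mathlib.Data.Matrix.ColumnRowPartitioned
import Mathlib.LinearAlgebra.FiniteDimensional.Lemmas
import Mathlib.InformationTheory.Hamming
import Mathlib.RingTheory.AdjoinRoot
import Mathlib.RingTheory.EuclideanDomain
import Mathlib.LinearAlgebra.Dimension.RankNullity
import Mathlib.RingTheory.Ideal.Quotient.Operations
import HarnessLib

/-!
# Abelian two-block (group-algebra) CSS check matrices: commutation, `rank H_X = rank H_Z`,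
# `k = 2 · dim (ker A ∩ ker B)`, and the `X ↔ Z` symmetry

A *two-block* CSS code is given by two commuting square matrices `A, B` through the check matrices
`H_X = [A | B]`, `H_Z = [Bᵀ | Aᵀ]` (Kovalev–Pryadko, PRA 88 (2013) 012311 = arXiv:1212.6703, §III.B
eq. (11) [KovalevPryadko2013Hyperbicycle]; Lin–Pryadko, PRA 109 (2024) 022407 = arXiv:2306.16400, §III eq. (10)
[LinPryadko2024]; Bravyi–Cross–Gambetta–Maslov–Rall–Yoder, Nature 627 (2024) 778–782 =
arXiv:2308.07915, §4 / Methods eq. (2) [BravyiEtAl2024]).  When `A = L(a)` and `B = L(b)` are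
multiplication operators by elements `a, b` of the group algebra `F[G]` of a finite **abelian** group
`G`, both are `G`-circulant matrices — in Mathlib's language `Matrix.circulant a` with index type `G`
(`circulant v i j = v (i - j)`) — and they commute automatically (`Matrix.circulant_mul_comm`).  This
covers at once:
* generalized-bicycle (GB) codes, `G = ℤ_ℓ` (circulant `A, B`) [KovalevPryadko2013, §III.B;
  Panteleev–Kalachev, Quantum 5 (2021) 585 = arXiv:1904.02703, §4];
* bivariate-bicycle (BB) codes, `G = ℤ_ℓ × ℤ_m`, `A, B` sums of three monomials `xⁱyʲ`
  [BravyiEtAl2024, §4];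
* abelian two-block group-algebra (2BGA) codes [LinPryadko2024, §IV; Kalachev–Panteleev 2020].

Proved here, for an arbitrary finite additive commutative group `G` as index type and (where ranks
are involved) an arbitrary field `F`:
* `HX_mul_HZ_transpose` : `H_X H_Zᵀ = 2 • (A B)`, hence `= 0` in characteristic two
  (`HX_mul_HZ_transpose_eq_zero`) — the CSS commutation [BravyiEtAl2024, §4: "H^X (H^Z)^T = AB + BA = 0"];
* `HZ_eq_submatrix` : `H_Z` is `H_X` with rows re-indexed by `g ↦ -g` and columns by the involution
  `colSwap : (inl g ↦ inr (-g), inr g ↦ inl (-g))` — the matrix identity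
  `H_Z = C H_X [[0,C],[C,0]]` of the proof of [BravyiEtAl2024, Lemma 1] (there `C = C_ℓ ⊗ C_m`,
  `C_ℓ S_ℓ C_ℓ = S_ℓᵀ`), valid verbatim for every abelian `G`;
* `rank_HZ` : `rank H_Z = rank H_X` ([BravyiEtAl2024, Lemma 1, proof]; [LinPryadko2024, §IV.E:
  "for an abelian group G, it is known that rank H_X = rank H_Z, and the code dimension is even"]);
* `ker_HZ_transpose` : `ker H_Zᵀ = ker A ⊓ ker B`;
* `rank_HX_add_finrank_ker` and `two_card_eq` : `rank H_X + dim (ker A ⊓ ker B) = |G|`, i.e. the CSS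
  dimension `k = 2|G| − rank H_X − rank H_Z` equals `2 · dim (ker A ∩ ker B)` — the `(n, k)` part of
  [BravyiEtAl2024, Lemma 1] ("k = 2 · dim (ker A ∩ ker B)"), for every abelian two-block code;
* `mulVec_comp_colSwap`, `mem_range_vecMulLinear_comp_colSwap` : the coordinate permutation
  `w ↦ w ∘ colSwap` (which preserves Hamming weight, `hammingNorm_comp_colSwap`) exchanges
  `ker H_X` with `ker H_Z` and the row space of `H_Z` with the row space of `H_X`; consequently any
  weight-based distance satisfies `d_X = d_Z` — the map `(α, β) ↦ (Cβ, Cα)` of the proof of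
  [BravyiEtAl2024, Lemma 1] ("The code offers equal distance for X-type and Z-type errors"), again for
  every abelian `G` ([LinPryadko2024, §IV.B: abelian `G` ⇒ `LP[a,b] ≅ LP[b,a]` ⇒ `d_X = d_Z`]).

Named fact (D-0014, statement as printed, proof not vendored): `PanteleevKalachev2021_prop1`, the GB
dimension formula `rank H_X = rank H_Z = ℓ − deg gcd(a(x), b(x), x^ℓ − 1)` (so `k = 2 deg gcd`)
[PanteleevKalachev2021, Prop. 1].

## What is NOT here (deliberately)
* The quantum code itself (stabilizer group, code space, distance as a number): those are the
  venture's own definitions under `Summits/Ventures/QEC/Basic/` (LADDER-QEC PARTITION rows type-01/02/05);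
  this file is pure linear algebra of the printed check matrices, to be imported there.  In particular
  the distance statement is given in transport form (kernel/row-space exchange under a weight-preserving
  coordinate permutation), which yields `d_X = d_Z` for whichever distance definition is applied.
* Non-abelian two-block group-algebra codes (`A = L(a)`, `B = R(b)`, left/right multiplication), where
  `rank H_X ≠ rank H_Z` can happen [LinPryadko2024, Example 11]: not circulant, not covered.
* The specific codes `[[72,12,6]]`, …, `[[288,12,18]]` of [BravyiEtAl2024, Table 3]: CLAIMS typed
  Summits-side until the venture's certificates discharge them.

`lean search` (2026-08-26): Mathlib has `Matrix.circulant`, `circulant_mul_comm`, `transpose_circulant`,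
`rank_submatrix`, `rank_transpose`, `fromCols`/`fromRows`; no two-block / CSS check-matrix declarations
exist in Mathlib or the tree (`Literature.InformationTheory.QuantumCodes.SymplecticCodes` has the
symplectic-space side: `cssSpace`, `IsAdditiveCode`).
-/

namespace Literature.InformationTheory.QuantumCodes

namespace AbelianTwoBlock

open Matrix

variable {G : Type*} {R : Type*}

section Defs

variable [Sub G]

/-- The `X`-check matrix `H_X = [A | B]` of the two-block code on the pair of `G`-circulant matrices
`A = circulant a`, `B = circulant b` (columns indexed by the two blocks `G ⊕ G` of qubits).
[cite: BravyiEtAl2024, §4 eq. "H^X = [A|B]" (arXiv:2308.07915 §4; Nature 627 Methods eq. (2))] -/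
def HX (a b : G → R) : Matrix G (G ⊕ G) R := fromCols (circulant a) (circulant b)

/-- The `Z`-check matrix `H_Z = [Bᵀ | Aᵀ]` of the two-block code on `A = circulant a`, `B = circulant b`.
[cite: BravyiEtAl2024, §4 eq. "H^Z = [B^T|A^T]" (arXiv:2308.07915 §4; Nature 627 Methods eq. (2))] -/
def HZ (a b : G → R) : Matrix G (G ⊕ G) R := fromCols (circulant b)ᵀ (circulant a)ᵀ

/-- Unfolding of `HX`: `H_X = [A | B]`.
[cite: BravyiEtAl2024, §4 eq. "H^X = [A|B]" (arXiv:2308.07915 §4)] -/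
theorem HX_def (a b : G → R) : HX a b = fromCols (circulant a) (circulant b) := rfl

/-- Unfolding of `HZ`: `H_Z = [Bᵀ | Aᵀ]`.
[cite: BravyiEtAl2024, §4 eq. "H^Z = [B^T|A^T]" (arXiv:2308.07915 §4)] -/
theorem HZ_def (a b : G → R) : HZ a b = fromCols (circulant b)ᵀ (circulant a)ᵀ := rfl

/-- `H_Zᵀ` is the row-stacked matrix `[B ; A]` (used in the printed proof as
"`ker((H^Z)^T) = ker(A) ∩ ker(B)` since `H^Z = [B^T|A^T]`").
[cite: BravyiEtAl2024, proof of Lemma 1 (arXiv:2308.07915 §4; Nature 627 Suppl. Inf. §3)] -/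
theorem transpose_HZ (a b : G → R) : (HZ a b)ᵀ = fromRows (circulant b) (circulant a) := by
  rw [HZ, transpose_fromCols, transpose_transpose, transpose_transpose]

end Defs

section Commutation

variable [Fintype G] [AddCommGroup G] [CommRing R]

/-- CSS commutation for abelian two-block codes: `H_X H_Zᵀ = A B + B A = 2 • (A B)`, because
`G`-circulant matrices commute.
[cite: BravyiEtAl2024, §4 "Any X-check and Z-check commute since … H^X (H^Z)^T = AB+BA = 0 (mod 2)" (arXiv:2308.07915 §4)] -/
theorem HX_mul_HZ_transpose (a b : G → R) :
    HX a b * (HZ a b)ᵀ = (2 : R) • (circulant a * circulant b) := by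
  rw [transpose_HZ, HX, fromCols_mul_fromRows, circulant_mul_comm b a, two_smul]

/-- In characteristic two (e.g. over `ZMod 2`) the `X`- and `Z`-checks of an abelian two-block code
commute: `H_X H_Zᵀ = 0`.
[cite: BravyiEtAl2024, §4 "H^X (H^Z)^T = AB+BA = 0 (mod 2)" (arXiv:2308.07915 §4)] -/
theorem HX_mul_HZ_transpose_eq_zero (h2 : (2 : R) = 0) (a b : G → R) :
    HX a b * (HZ a b)ᵀ = 0 := by
  rw [HX_mul_HZ_transpose, h2, zero_smul]

end Commutation

section Symmetry

variable [AddCommGroup G]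

/-- The column involution behind the `X ↔ Z` symmetry of an abelian two-block code: it sends qubit `g`
of the left block to qubit `-g` of the right block and vice versa (the permutation `[[0,C],[C,0]]`,
`C : g ↦ -g`, of the proof of [BravyiEtAl2024, Lemma 1]). [folklore] -/
def colSwap (G : Type*) [AddCommGroup G] : G ⊕ G ≃ G ⊕ G where
  toFun := Sum.elim (fun g => Sum.inr (-g)) (fun g => Sum.inl (-g))
  invFun := Sum.elim (fun g => Sum.inr (-g)) (fun g => Sum.inl (-g))
  left_inv := by rintro (g | g) <;> simp
  right_inv := by rintro (g | g) <;> simp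

/-- `colSwap` sends left-block qubit `g` to right-block qubit `-g`.
[cite: BravyiEtAl2024, proof of Lemma 1 (arXiv:2308.07915 §4; Nature 627 Suppl. Inf. §3)] -/
@[simp] theorem colSwap_inl (g : G) : colSwap G (Sum.inl g) = Sum.inr (-g) := rfl

/-- `colSwap` sends right-block qubit `g` to left-block qubit `-g`.
[cite: BravyiEtAl2024, proof of Lemma 1 (arXiv:2308.07915 §4; Nature 627 Suppl. Inf. §3)] -/
@[simp] theorem colSwap_inr (g : G) : colSwap G (Sum.inr g) = Sum.inl (-g) := rfl

/-- `colSwap` is its own inverse (the matrix `[[0,C],[C,0]]` with `C² = 1` is self-inverse).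
[cite: BravyiEtAl2024, proof of Lemma 1 (arXiv:2308.07915 §4; Nature 627 Suppl. Inf. §3)] -/
@[simp] theorem colSwap_symm : (colSwap G).symm = colSwap G := rfl

/-- `colSwap` is an involution.
[cite: BravyiEtAl2024, proof of Lemma 1 (arXiv:2308.07915 §4; Nature 627 Suppl. Inf. §3)] -/
theorem colSwap_colSwap (j : G ⊕ G) : colSwap G (colSwap G j) = j := (colSwap G).left_inv j

/-- For an abelian index group the transpose of a circulant matrix is the same circulant matrix with
rows and columns re-indexed by negation: `(circulant v)ᵀ i j = v (j - i) = circulant v (-i) (-j)`.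
(This is `C_ℓ S_ℓ C_ℓ = S_ℓᵀ` of [BravyiEtAl2024, proof of Lemma 1], for all of `F[G]` at once.) [cite: BravyiEtAl2024, proof of Lemma 1 (arXiv:2308.07915 §4; Nature 627 Suppl. Inf. §3)] -/
theorem transpose_circulant_eq_submatrix (v : G → R) :
    (circulant v)ᵀ = (circulant v).submatrix (fun i => -i) (fun j => -j) := by
  ext i j
  simp [circulant_apply, sub_neg_eq_add, neg_add_eq_sub]

/-- `H_Z = C · H_X · [[0,C],[C,0]]` as a re-indexing: `H_Z` is the submatrix of `H_X` along the row map
`g ↦ -g` and the column involution `colSwap`.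
[cite: BravyiEtAl2024, proof of Lemma 1, eq. "H^Z = [B^T|A^T] = [CBC|CAC] = C H^X [[0,C],[C,0]]" (arXiv:2308.07915 §4; Nature 627 Suppl. Inf. §3)] -/
theorem HZ_eq_submatrix (a b : G → R) :
    HZ a b = (HX a b).submatrix (fun i => -i) (colSwap G) := by
  ext i (j | j)
  · simp [HZ, HX, circulant_apply, sub_neg_eq_add, neg_add_eq_sub]
  · simp [HZ, HX, circulant_apply, sub_neg_eq_add, neg_add_eq_sub]

/-- Symmetrically, `H_X` is the same re-indexing of `H_Z`. [cite: BravyiEtAl2024, proof of Lemma 1 (arXiv:2308.07915 §4; Nature 627 Suppl. Inf. §3)] -/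
theorem HX_eq_submatrix (a b : G → R) :
    HX a b = (HZ a b).submatrix (fun i => -i) (colSwap G) := by
  ext i (j | j)
  · simp [HZ, HX, circulant_apply, sub_neg_eq_add, neg_add_eq_sub]
  · simp [HZ, HX, circulant_apply, sub_neg_eq_add, neg_add_eq_sub]

variable [Fintype G]

/-- `rank H_Z = rank H_X` for every abelian two-block code (any commutative semiring of coefficients).
[cite: BravyiEtAl2024, proof of Lemma 1 "Thus H^Z is obtained from H^X by multiplying on the left and on the right by invertible matrices. This implies rk(H^X) = rk(H^Z)" (arXiv:2308.07915 §4)] -/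
theorem rank_HZ [CommRing R] (a b : G → R) : (HZ a b).rank = (HX a b).rank := by
  rw [HZ_eq_submatrix]
  exact rank_submatrix (HX a b) (Equiv.neg G) (colSwap G)

/-- Kernel transport: `H_X u = 0 ↔ H_Z (u ∘ colSwap) = 0` — the weight-preserving coordinate
permutation `colSwap` carries `ker H_X` onto `ker H_Z` (the map `(α,β) ↦ (Cβ, Cα)` of
[BravyiEtAl2024, proof of Lemma 1]). [cite: BravyiEtAl2024, proof of Lemma 1 (arXiv:2308.07915 §4; Nature 627 Suppl. Inf. §3)] -/
theorem HZ_mulVec_comp_colSwap [CommRing R] (a b : G → R) (u : G ⊕ G → R) :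
    HZ a b *ᵥ (u ∘ colSwap G) = (HX a b *ᵥ u) ∘ (fun i => -i) := by
  ext i
  rw [HZ_eq_submatrix]
  simp only [mulVec, dotProduct, submatrix_apply, Function.comp_apply]
  exact Fintype.sum_equiv (colSwap G) _ _ (fun j => by simp)

/-- Symmetric form: `H_X (u ∘ colSwap) = (H_Z u) ∘ (g ↦ -g)`. [cite: BravyiEtAl2024, proof of Lemma 1 (arXiv:2308.07915 §4; Nature 627 Suppl. Inf. §3)] -/
theorem HX_mulVec_comp_colSwap [CommRing R] (a b : G → R) (u : G ⊕ G → R) :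
    HX a b *ᵥ (u ∘ colSwap G) = (HZ a b *ᵥ u) ∘ (fun i => -i) := by
  ext i
  rw [HX_eq_submatrix]
  simp only [mulVec, dotProduct, submatrix_apply, Function.comp_apply]
  exact Fintype.sum_equiv (colSwap G) _ _ (fun j => by simp)

/-- `u ∈ ker H_X ↔ u ∘ colSwap ∈ ker H_Z`. [cite: BravyiEtAl2024, proof of Lemma 1 (arXiv:2308.07915 §4; Nature 627 Suppl. Inf. §3)] -/
theorem HX_mulVec_eq_zero_iff [CommRing R] (a b : G → R) (u : G ⊕ G → R) :
    HX a b *ᵥ u = 0 ↔ HZ a b *ᵥ (u ∘ colSwap G) = 0 := by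
  rw [HZ_mulVec_comp_colSwap]
  constructor
  · intro h
    rw [h]
    rfl
  · intro h
    funext i
    have := congr_fun h (-i)
    simpa using this

/-- `u ∈ ker H_Z ↔ u ∘ colSwap ∈ ker H_X`. [cite: BravyiEtAl2024, proof of Lemma 1 (arXiv:2308.07915 §4; Nature 627 Suppl. Inf. §3)] -/
theorem HZ_mulVec_eq_zero_iff [CommRing R] (a b : G → R) (u : G ⊕ G → R) :
    HZ a b *ᵥ u = 0 ↔ HX a b *ᵥ (u ∘ colSwap G) = 0 := by
  rw [HX_mulVec_comp_colSwap]
  constructor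
  · intro h
    rw [h]
    rfl
  · intro h
    funext i
    have := congr_fun h (-i)
    simpa using this

/-- Row-space transport: `u` is in the row space of `H_Z` iff `u ∘ colSwap` is in the row space of
`H_X` (rows of `H_Z` are the rows of `H_X`, re-indexed, composed with `colSwap`). [cite: BravyiEtAl2024, proof of Lemma 1 (arXiv:2308.07915 §4; Nature 627 Suppl. Inf. §3)] -/
theorem vecMul_HZ_comp_colSwap [CommRing R] (a b : G → R) (w : G → R) :
    (w ᵥ* HZ a b) ∘ colSwap G = (w ∘ fun i => -i) ᵥ* HX a b := by
  ext j
  rw [HZ_eq_submatrix]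
  simp only [vecMul, dotProduct, submatrix_apply, Function.comp_apply, colSwap_colSwap]
  exact Fintype.sum_equiv (Equiv.neg G) _ _ (fun i => by simp)

/-- Symmetric form of `vecMul_HZ_comp_colSwap`. [cite: BravyiEtAl2024, proof of Lemma 1 (arXiv:2308.07915 §4; Nature 627 Suppl. Inf. §3)] -/
theorem vecMul_HX_comp_colSwap [CommRing R] (a b : G → R) (w : G → R) :
    (w ᵥ* HX a b) ∘ colSwap G = (w ∘ fun i => -i) ᵥ* HZ a b := by
  ext j
  rw [HX_eq_submatrix]
  simp only [vecMul, dotProduct, submatrix_apply, Function.comp_apply, colSwap_colSwap]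
  exact Fintype.sum_equiv (Equiv.neg G) _ _ (fun i => by simp)

/-- `u ∈ rowspace H_Z ↔ u ∘ colSwap ∈ rowspace H_X`. [cite: BravyiEtAl2024, proof of Lemma 1 (arXiv:2308.07915 §4; Nature 627 Suppl. Inf. §3)] -/
theorem mem_range_vecMulLinear_HZ_iff [CommRing R] (a b : G → R) (u : G ⊕ G → R) :
    u ∈ LinearMap.range (HZ a b).vecMulLinear ↔
      u ∘ colSwap G ∈ LinearMap.range (HX a b).vecMulLinear := by
  simp only [LinearMap.mem_range, Matrix.vecMulLinear_apply]
  constructor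
  · rintro ⟨w, rfl⟩
    exact ⟨w ∘ fun i => -i, (vecMul_HZ_comp_colSwap a b w).symm⟩
  · rintro ⟨w, hw⟩
    refine ⟨w ∘ fun i => -i, ?_⟩
    have h := vecMul_HX_comp_colSwap a b w
    rw [hw] at h
    funext j
    have := congr_fun h j
    simpa [colSwap_colSwap] using this.symm

/-- `u ∈ rowspace H_X ↔ u ∘ colSwap ∈ rowspace H_Z`. [cite: BravyiEtAl2024, proof of Lemma 1 (arXiv:2308.07915 §4; Nature 627 Suppl. Inf. §3)] -/
theorem mem_range_vecMulLinear_HX_iff [CommRing R] (a b : G → R) (u : G ⊕ G → R) :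
    u ∈ LinearMap.range (HX a b).vecMulLinear ↔
      u ∘ colSwap G ∈ LinearMap.range (HZ a b).vecMulLinear := by
  rw [mem_range_vecMulLinear_HZ_iff]
  have : (u ∘ colSwap G) ∘ colSwap G = u := by
    funext j
    simp [colSwap_colSwap]
  rw [this]

/-- The coordinate permutation `colSwap` preserves Hamming weight. [cite: BravyiEtAl2024, proof of Lemma 1 (arXiv:2308.07915 §4; Nature 627 Suppl. Inf. §3)] -/
theorem hammingNorm_comp_colSwap [Zero R] [DecidableEq R] (u : G ⊕ G → R) :
    hammingNorm (u ∘ colSwap G) = hammingNorm u := by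
  unfold hammingNorm
  exact Finset.card_equiv (colSwap G) (fun j => by simp)

/-- `X ↔ Z` symmetry of abelian two-block codes in transport form: the weight-preserving coordinate
permutation `u ↦ u ∘ colSwap` maps the `Z`-type logical representatives `ker H_X ∖ rowspace H_Z`
bijectively onto the `X`-type ones `ker H_Z ∖ rowspace H_X`; hence `d_X = d_Z` for the minimum-weight
distances.
[cite: BravyiEtAl2024, Lemma 1 "The code offers equal distance for X-type and Z-type errors", proof via (α,β) ↦ (Cβ,Cα) (arXiv:2308.07915 §4)] -/
theorem zLogical_iff_xLogical_comp_colSwap [CommRing R] (a b : G → R) (u : G ⊕ G → R) :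
    (HX a b *ᵥ u = 0 ∧ u ∉ LinearMap.range (HZ a b).vecMulLinear) ↔
      (HZ a b *ᵥ (u ∘ colSwap G) = 0 ∧ u ∘ colSwap G ∉ LinearMap.range (HX a b).vecMulLinear) := by
  rw [HX_mulVec_eq_zero_iff, mem_range_vecMulLinear_HZ_iff]

end Symmetry

section Dimension

variable [Fintype G] [AddCommGroup G] {F : Type*} [Field F]

/-- `ker H_Zᵀ = ker A ⊓ ker B` (as `H_Zᵀ = [B ; A]`).
[cite: BravyiEtAl2024, proof of Lemma 1 "ker((H^Z)^T) = ker(A) ∩ ker(B) since H^Z = [B^T|A^T]" (arXiv:2308.07915 §4)] -/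
theorem ker_HZ_transpose [DecidableEq G] (a b : G → F) :
    LinearMap.ker (HZ a b)ᵀ.mulVecLin =
      LinearMap.ker (circulant a).mulVecLin ⊓ LinearMap.ker (circulant b).mulVecLin := by
  ext v
  simp only [LinearMap.mem_ker, Submodule.mem_inf, Matrix.mulVecLin_apply, transpose_HZ,
    fromRows_mulVec]
  constructor
  · intro h
    exact ⟨funext fun i => by simpa using congr_fun h (Sum.inr i),
      funext fun i => by simpa using congr_fun h (Sum.inl i)⟩
  · rintro ⟨ha, hb⟩
    funext i
    rcases i with i | i
    · simpa using congr_fun hb i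
    · simpa using congr_fun ha i

/-- Rank–nullity for `H_Zᵀ : F^G → F^{G ⊕ G}` combined with `rank H_Z = rank H_Zᵀ`:
`rank H_Z + dim (ker A ⊓ ker B) = |G|`. [cite: BravyiEtAl2024, proof of Lemma 1 (arXiv:2308.07915 §4; Nature 627 Suppl. Inf. §3)] -/
theorem rank_HZ_add_finrank_ker [DecidableEq G] (a b : G → F) :
    (HZ a b).rank + Module.finrank F
      ↥(LinearMap.ker (circulant a).mulVecLin ⊓ LinearMap.ker (circulant b).mulVecLin) =
      Fintype.card G := by
  rw [← ker_HZ_transpose, ← rank_transpose (HZ a b), Matrix.rank,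
    LinearMap.finrank_range_add_finrank_ker, Module.finrank_fintype_fun_eq_card]

/-- `rank H_X + dim (ker A ⊓ ker B) = |G|` for every abelian two-block code over a field.
[cite: BravyiEtAl2024, proof of Lemma 1 (arXiv:2308.07915 §4)] -/
theorem rank_HX_add_finrank_ker [DecidableEq G] (a b : G → F) :
    (HX a b).rank + Module.finrank F
      ↥(LinearMap.ker (circulant a).mulVecLin ⊓ LinearMap.ker (circulant b).mulVecLin) =
      Fintype.card G := by
  rw [← rank_HZ a b]
  exact rank_HZ_add_finrank_ker a b

/-- The dimension count of [BravyiEtAl2024, Lemma 1] for every abelian two-block code over a field: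
with `n = 2|G|` qubits, `n = rank H_X + rank H_Z + 2 · dim (ker A ⊓ ker B)`, i.e. the CSS dimension
`k = n − rank H_X − rank H_Z` equals `2 · dim (ker A ∩ ker B)` (in particular `k` is even,
[LinPryadko2024, §IV.E]).
[cite: BravyiEtAl2024, Lemma 1 "k = 2 · dim(ker A ∩ ker B)" (arXiv:2308.07915 §4; Nature 627 Methods Lemma 1)] -/
theorem two_mul_card_eq_rank_add [DecidableEq G] (a b : G → F) :
    2 * Fintype.card G = (HX a b).rank + (HZ a b).rank + 2 * Module.finrank F
      ↥(LinearMap.ker (circulant a).mulVecLin ⊓ LinearMap.ker (circulant b).mulVecLin) := by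
  have h1 := rank_HX_add_finrank_ker a b
  have h2 := rank_HZ_add_finrank_ker a b
  omega

end Dimension

end AbelianTwoBlock

section GBDimension

open Matrix Polynomial

/-- The polynomial `a(x) = Σ_i a_i xⁱ ∈ F₂[x]` attached to a coefficient vector `a : Fin ℓ → F₂`
(the first column of the circulant matrix `circulant a`). [folklore] -/
noncomputable def gbPoly {ℓ : ℕ} (a : Fin ℓ → ZMod 2) : Polynomial (ZMod 2) :=
  ∑ i : Fin ℓ, Polynomial.monomial (i : ℕ) (a i)

/-- **Panteleev–Kalachev 2021, Proposition 1** (dimension of generalized-bicycle codes), as printed: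
"The dimension `k` of the generalized bicycle `[[2ℓ, k]]` code defined by polynomials
`a(x), b(x) ∈ F₂[x]/(x^ℓ − 1)` is given by the formula `k = 2 deg g(x)`, where
`g(x) = gcd(a(x), b(x), x^ℓ − 1)`"; the printed proof shows `rk H_X = rk H_Z = ℓ − deg g(x)`
(the column space of `H_X = [A, B]`, `A = a(P)`, `B = b(P)` circulant, is the cyclic code generated by
`g`).  Typed in rank form (no `ℕ`-subtraction): for the `ℤ_ℓ`-circulant check matrices,
`rank H_X + deg g = ℓ` and `rank H_Z + deg g = ℓ`, so that `k = 2ℓ − rank H_X − rank H_Z = 2 deg g`.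
Here `circulant a` (entry `(i,j) ↦ a (i - j)`) is the printed circulant with first column `a`, and
`g` is computed in `F₂[x]` from the lifts `gbPoly a`, `gbPoly b` of degree `< ℓ`.
[cite: PanteleevKalachev2021, Prop. 1 (arXiv:1904.02703 §4.3; Quantum 5, 585, §4.3)] -/
def PanteleevKalachev2021_prop1 : Prop :=
  ∀ (ℓ : ℕ) [NeZero ℓ] (a b : Fin ℓ → ZMod 2),
    let g := EuclideanDomain.gcd (EuclideanDomain.gcd (gbPoly a) (gbPoly b))
      ((Polynomial.X : Polynomial (ZMod 2)) ^ ℓ - 1)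
    (AbelianTwoBlock.HX a b).rank + g.natDegree = ℓ ∧ (AbelianTwoBlock.HZ a b).rank + g.natDegree = ℓ

end GBDimension

/-! ## Proof of the GB dimension formula (discharge of `PanteleevKalachev2021_prop1`)

Route (as printed in [PanteleevKalachev2021, proof of Prop. 1]): identify `F^ℓ` with
`R_ℓ = F[x]/(x^ℓ − 1)` through the power basis; the circulant matrix of `a` becomes multiplication by
`a(x)`; the column space of `[A | B]` becomes the ideal `(a(x)) + (b(x)) = (g)`, `g = gcd(a, b, x^ℓ − 1)`;
and `dim_F (g)·R_ℓ = ℓ − deg g` because `R_ℓ/(g) ≅ F[x]/(g)`. -/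

section GBDimensionProof

open Matrix Polynomial

namespace GBDim

variable {F : Type*} [Field F] {ℓ : ℕ}

/-- The polynomial `Σ_i v_i xⁱ` of a coefficient vector. [folklore] -/
noncomputable def vecPoly (v : Fin ℓ → F) : F[X] := ∑ i : Fin ℓ, monomial (i : ℕ) (v i)

/-- The modulus `x^ℓ - 1`. [folklore] -/
private noncomputable def modulus (F : Type*) [Field F] (ℓ : ℕ) : F[X] := X ^ ℓ - 1

/-- `x^ℓ - 1` is monic. [folklore] -/
private theorem modulus_monic [NeZero ℓ] : (modulus F ℓ).Monic := by
  unfold modulus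
  rw [← C_1]
  exact monic_X_pow_sub_C (1 : F) (NeZero.ne ℓ)

/-- `deg (x^ℓ - 1) = ℓ`. [folklore] -/
private theorem natDegree_modulus [NeZero ℓ] : (modulus F ℓ).natDegree = ℓ := by
  unfold modulus
  rw [← C_1]
  exact natDegree_X_pow_sub_C

/-- `x^ℓ - 1 ≠ 0`. [folklore] -/
private theorem modulus_ne_zero [NeZero ℓ] : modulus F ℓ ≠ 0 := (modulus_monic (F := F) (ℓ := ℓ)).ne_zero

/-- `R_ℓ = F[x]/(x^ℓ - 1)`. [folklore] -/
private abbrev Rmod (F : Type*) [Field F] (ℓ : ℕ) : Type _ := AdjoinRoot (modulus F ℓ)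

/-- `x^ℓ = 1` in `R_ℓ`. [folklore] -/
private theorem root_pow_card [NeZero ℓ] : AdjoinRoot.root (modulus F ℓ) ^ ℓ = 1 := by
  have h : AdjoinRoot.mk (modulus F ℓ) (modulus F ℓ) = 0 := AdjoinRoot.mk_self
  unfold modulus at h
  rw [map_sub, map_pow, AdjoinRoot.mk_X, map_one, sub_eq_zero] at h
  exact h

/-- `x^n = x^(n mod ℓ)` in `R_ℓ`. [folklore] -/
private theorem root_pow_eq_pow_mod [NeZero ℓ] (n : ℕ) :
    AdjoinRoot.root (modulus F ℓ) ^ n = AdjoinRoot.root (modulus F ℓ) ^ (n % ℓ) := by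
  conv_lhs => rw [← Nat.div_add_mod n ℓ, pow_add, pow_mul, root_pow_card, one_pow, one_mul]

/-- The power basis `1, x, …, x^{ℓ-1}` of `R_ℓ`, indexed by `Fin ℓ`. [folklore] -/
private noncomputable def xBasis (F : Type*) [Field F] (ℓ : ℕ) [NeZero ℓ] : Module.Basis (Fin ℓ) F (Rmod F ℓ) :=
  (AdjoinRoot.powerBasis' (modulus_monic (F := F) (ℓ := ℓ))).basis.reindex
    (finCongr (natDegree_modulus (F := F) (ℓ := ℓ)))

/-- `xBasis i = x^i`. [folklore] -/
private theorem xBasis_apply [NeZero ℓ] (i : Fin ℓ) :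
    xBasis F ℓ i = AdjoinRoot.root (modulus F ℓ) ^ (i : ℕ) := by
  rw [xBasis, Module.Basis.reindex_apply, PowerBasis.coe_basis]
  simp [finCongr_symm, finCongr_apply]

/-- The coordinate isomorphism `φ : F^ℓ ≃ R_ℓ`, `v ↦ Σ v_i xⁱ`. [folklore] -/
private noncomputable def φ (F : Type*) [Field F] (ℓ : ℕ) [NeZero ℓ] : (Fin ℓ → F) ≃ₗ[F] Rmod F ℓ :=
  (xBasis F ℓ).equivFun.symm

/-- `φ v = Σ v_i xⁱ`. [folklore] -/
private theorem φ_apply [NeZero ℓ] (v : Fin ℓ → F) :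
    φ F ℓ v = ∑ i : Fin ℓ, v i • AdjoinRoot.root (modulus F ℓ) ^ (i : ℕ) := by
  rw [φ, Module.Basis.equivFun_symm_apply]
  simp [xBasis_apply]

/-- `φ v` is the class of the polynomial `Σ v_i Xⁱ`. [folklore] -/
private theorem mk_vecPoly [NeZero ℓ] (v : Fin ℓ → F) :
    AdjoinRoot.mk (modulus F ℓ) (vecPoly v) = φ F ℓ v := by
  rw [φ_apply, vecPoly, map_sum]
  refine Finset.sum_congr rfl fun i _ => ?_
  rw [← C_mul_X_pow_eq_monomial, map_mul, map_pow, AdjoinRoot.mk_X, AdjoinRoot.mk_C,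
    Algebra.smul_def, AdjoinRoot.algebraMap_eq]

/-- `φ e_j = x^j`. [folklore] -/
private theorem φ_single [NeZero ℓ] (j : Fin ℓ) :
    φ F ℓ (Pi.single j 1) = AdjoinRoot.root (modulus F ℓ) ^ (j : ℕ) := by
  rw [φ_apply, Finset.sum_eq_single j]
  · simp
  · intro i _ hij
    simp [hij]
  · intro h
    exact absurd (Finset.mem_univ j) h

/-- The intertwining relation: `φ (circulant a · e_j) = a(x) · x^j`, i.e. multiplication by the
circulant matrix of `a` is multiplication by `a(x)` in `R_ℓ`. [folklore] -/
private theorem φ_circulant_col [NeZero ℓ] (a : Fin ℓ → F) (j : Fin ℓ) :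
    φ F ℓ (fun i => a (i - j)) =
      AdjoinRoot.mk (modulus F ℓ) (vecPoly a) * AdjoinRoot.root (modulus F ℓ) ^ (j : ℕ) := by
  rw [mk_vecPoly, φ_apply, φ_apply, Finset.sum_mul]
  simp_rw [smul_mul_assoc, ← pow_add]
  -- reindex the left sum by `i ↦ i + j`
  refine (Fintype.sum_equiv (Equiv.addRight j) _ _ fun i => ?_).symm
  simp only [Equiv.coe_addRight, add_sub_cancel_right]
  congr 1
  rw [root_pow_eq_pow_mod ((i : ℕ) + (j : ℕ)), Fin.val_add]

/-- Multiplication by the circulant matrix of `a` is multiplication by `a(x)` in `R_ℓ` (under `φ`): the printed identification of the ring of `ℓ × ℓ` circulants with `F[x]/(x^ℓ - 1)` [PanteleevKalachev2021, §4.2]. [folklore] -/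
private theorem φ_mulVec_circulant [NeZero ℓ] (a v : Fin ℓ → F) :
    φ F ℓ (circulant a *ᵥ v) = AdjoinRoot.mk (modulus F ℓ) (vecPoly a) * φ F ℓ v := by
  -- both sides are linear in `v`; compare on the standard basis
  suffices h : (φ F ℓ).toLinearMap ∘ₗ (circulant a).mulVecLin =
      LinearMap.mulLeft F (AdjoinRoot.mk (modulus F ℓ) (vecPoly a)) ∘ₗ (φ F ℓ).toLinearMap by
    simpa using LinearMap.congr_fun h v
  refine (Pi.basisFun F (Fin ℓ)).ext fun j => ?_
  simp only [Pi.basisFun_apply, LinearMap.coe_comp, Function.comp_apply, Matrix.mulVecLin_apply,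
    LinearEquiv.coe_coe, LinearMap.mulLeft_apply]
  rw [Matrix.mulVec_single_one, φ_single, ← φ_circulant_col]
  rfl

/-- Under `φ`, the column space of `circulant a` is the principal ideal `(a(x))` of `R_ℓ`. [folklore] -/
private theorem map_φ_range_circulant [NeZero ℓ] (a : Fin ℓ → F) :
    (LinearMap.range (circulant a).mulVecLin).map (φ F ℓ).toLinearMap =
      (Ideal.span {AdjoinRoot.mk (modulus F ℓ) (vecPoly a)}).restrictScalars F := by
  ext y
  simp only [Submodule.mem_map, LinearMap.mem_range, Matrix.mulVecLin_apply, LinearEquiv.coe_coe,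
    Submodule.restrictScalars_mem, Ideal.mem_span_singleton]
  constructor
  · rintro ⟨_, ⟨v, rfl⟩, rfl⟩
    exact ⟨φ F ℓ v, by rw [φ_mulVec_circulant]⟩
  · rintro ⟨c, rfl⟩
    refine ⟨circulant a *ᵥ (φ F ℓ).symm c, ⟨_, rfl⟩, ?_⟩
    rw [φ_mulVec_circulant, LinearEquiv.apply_symm_apply]

/-- The column space of `[A | B]` is the sum of the column spaces. [folklore] -/
private theorem range_fromCols {m n₁ n₂ : Type*} [Fintype n₁] [Fintype n₂]
    (A : Matrix m n₁ F) (B : Matrix m n₂ F) :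
    LinearMap.range (fromCols A B).mulVecLin =
      LinearMap.range A.mulVecLin ⊔ LinearMap.range B.mulVecLin := by
  apply le_antisymm
  · rintro _ ⟨v, rfl⟩
    rw [Matrix.mulVecLin_apply, fromCols_mulVec]
    exact Submodule.add_mem _ (Submodule.mem_sup_left ⟨_, rfl⟩) (Submodule.mem_sup_right ⟨_, rfl⟩)
  · refine sup_le ?_ ?_
    · rintro _ ⟨u, rfl⟩
      refine ⟨Sum.elim u 0, ?_⟩
      simp
    · rintro _ ⟨u, rfl⟩
      refine ⟨Sum.elim 0 u, ?_⟩
      simp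

/-- In `R = F[x]/(f)` (as `AdjoinRoot f`), the ideal `(ā) + (b̄)` equals the image of `(g)`,
`g = gcd(gcd(a,b), f)`. [folklore] -/
private theorem span_sup_span_eq_map_span_gcd [DecidableEq F] (f p q : F[X]) :
    Ideal.span {AdjoinRoot.mk f p} ⊔ Ideal.span {AdjoinRoot.mk f q} =
      (Ideal.span {EuclideanDomain.gcd (EuclideanDomain.gcd p q) f}).map (AdjoinRoot.mk f) := by
  have hself : (Ideal.span {f}).map (AdjoinRoot.mk f) = ⊥ := by
    rw [Ideal.map_span, Set.image_singleton, Ideal.span_singleton_eq_bot]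
    exact AdjoinRoot.mk_self
  rw [EuclideanDomain.span_gcd, ← Set.singleton_union, Ideal.span_union, EuclideanDomain.span_gcd,
    ← Set.singleton_union, Ideal.span_union, Ideal.map_sup, Ideal.map_sup, hself, sup_bot_eq,
    Ideal.map_span, Ideal.map_span, Set.image_singleton, Set.image_singleton]

/-- Dimension of the image of `(g)` in `F[x]/(x^ℓ - 1)` for monic `g ∣ x^ℓ - 1`: `dim + deg g = ℓ`. [folklore] -/
private theorem finrank_map_span_add [NeZero ℓ] (g : F[X]) (hg : g.Monic) (hgf : g ∣ modulus F ℓ) :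
    Module.finrank F ↥(((Ideal.span {g}).map (AdjoinRoot.mk (modulus F ℓ))).restrictScalars F) +
      g.natDegree = ℓ := by
  haveI : Module.Finite F (Rmod F ℓ) := (modulus_monic (F := F) (ℓ := ℓ)).finite_adjoinRoot
  have htot : Module.finrank F (Rmod F ℓ) = ℓ := by
    rw [(AdjoinRoot.powerBasis' (modulus_monic (F := F) (ℓ := ℓ))).finrank,
      AdjoinRoot.powerBasis'_dim, natDegree_modulus]
  have hle : Ideal.span {modulus F ℓ} ≤ Ideal.span {g} :=
    Ideal.span_singleton_le_span_singleton.mpr hgf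
  have h2 : Module.finrank F (F[X] ⧸ Ideal.span {g}) = g.natDegree := by
    change Module.finrank F (AdjoinRoot g) = g.natDegree
    rw [(AdjoinRoot.powerBasis' hg).finrank, AdjoinRoot.powerBasis'_dim]
  have hq : Module.finrank F (Rmod F ℓ ⧸
      (((Ideal.span {g}).map (AdjoinRoot.mk (modulus F ℓ))).restrictScalars F)) = g.natDegree := by
    rw [(Submodule.Quotient.restrictScalarsEquiv F
      ((Ideal.span {g}).map (AdjoinRoot.mk (modulus F ℓ)))).finrank_eq, ← h2,
      ← (DoubleQuot.quotQuotEquivQuotOfLEₐ F hle).toLinearEquiv.finrank_eq]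
    rfl
  have h := Submodule.finrank_quotient_add_finrank
    (((Ideal.span {g}).map (AdjoinRoot.mk (modulus F ℓ))).restrictScalars F)
  rw [hq, htot, add_comm] at h
  exact h

/-- **GB rank formula over any field** (the content of the printed proofs): for `ℓ ≥ 1`,
`a, b : ℤ_ℓ → F` with polynomials `a(x) = vecPoly a`, `b(x) = vecPoly b` and
`g = gcd(gcd(a(x), b(x)), x^ℓ − 1)` monic (any gcd normalised to be monic),
`rank [circulant a | circulant b] + deg g = ℓ` — i.e. `rank H_X = ℓ − deg gcd(a, b, x^ℓ − 1)`
("`rank H_X = rank H_Z = ℓ − deg h(x)`, `k = 2 deg h(x)`, `h(x) ≡ gcd(a(x), b(x), x^ℓ − 1)`").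
Proof as printed in [PanteleevKalachev2021, Prop. 1]: the column space of `[A, B]` is, under
`F^ℓ ≅ F[x]/(x^ℓ − 1)`, the ideal `(a(x), b(x)) = (g(x))`, of dimension `ℓ − deg g`.
[cite: LinPryadko2024, §IV.E eq. "k = 2 deg h(x), h(x) ≡ gcd(a(x), b(x), x^ℓ − 1)" (arXiv:2306.16400); PanteleevKalachev2021, Prop. 1] -/
theorem rank_fromCols_circulant_add [NeZero ℓ] [DecidableEq F] (a b : Fin ℓ → F) (g : F[X])
    (hgdef : g = EuclideanDomain.gcd (EuclideanDomain.gcd (vecPoly a) (vecPoly b)) ((X : F[X]) ^ ℓ - 1))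
    (hg : g.Monic) :
    (fromCols (circulant a) (circulant b)).rank + g.natDegree = ℓ := by
  have hgdef' : g = EuclideanDomain.gcd (EuclideanDomain.gcd (vecPoly a) (vecPoly b)) (modulus F ℓ) :=
    hgdef
  have hgf : g ∣ modulus F ℓ := by
    rw [hgdef']
    exact EuclideanDomain.gcd_dvd_right _ _
  have hr : (fromCols (circulant a) (circulant b)).rank =
      Module.finrank F ↥(((Ideal.span {g}).map (AdjoinRoot.mk (modulus F ℓ))).restrictScalars F) := by
    unfold Matrix.rank
    rw [range_fromCols, ← LinearEquiv.finrank_map_eq (φ F ℓ), Submodule.map_sup,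
      map_φ_range_circulant, map_φ_range_circulant, ← Submodule.restrictScalars_sup,
      span_sup_span_eq_map_span_gcd, ← hgdef']
  rw [hr]
  exact finrank_map_span_add g hg hgf

end GBDim

/-- Over `F₂` every nonzero polynomial is monic. [folklore] -/
private theorem monic_of_ne_zero_zmod2 {g : Polynomial (ZMod 2)} (hg : g ≠ 0) : g.Monic := by
  have h : g.leadingCoeff ≠ 0 := leadingCoeff_ne_zero.mpr hg
  have key : ∀ x : ZMod 2, x ≠ 0 → x = 1 := by decide
  exact key _ h

/-- **Discharge** of the named fact `PanteleevKalachev2021_prop1` (Panteleev–Kalachev 2021,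
Proposition 1: the GB code on `a(x), b(x) ∈ F₂[x]/(x^ℓ − 1)` has `rank H_X = rank H_Z = ℓ − deg g`,
`g = gcd(a, b, x^ℓ − 1)`, hence `k = 2 deg g`), via `GBDim.rank_fromCols_circulant_add` (over `F₂`
every nonzero polynomial is monic, and `g ≠ 0` as `g ∣ x^ℓ − 1`) and `AbelianTwoBlock.rank_HZ`.
[cite: PanteleevKalachev2021, Prop. 1 (arXiv:1904.02703 §4.3; Quantum 5, 585, §4.3)] -/
theorem PanteleevKalachev2021_prop1_holds : PanteleevKalachev2021_prop1 := by
  intro ℓ _ a b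
  simp only
  set g := EuclideanDomain.gcd (EuclideanDomain.gcd (gbPoly a) (gbPoly b))
    ((Polynomial.X : Polynomial (ZMod 2)) ^ ℓ - 1) with hgdef
  have hg0 : g ≠ 0 := by
    intro h
    rw [hgdef, EuclideanDomain.gcd_eq_zero_iff] at h
    exact GBDim.modulus_ne_zero (F := ZMod 2) (ℓ := ℓ) h.2
  have hg : g.Monic := monic_of_ne_zero_zmod2 hg0
  have h1 : (AbelianTwoBlock.HX a b).rank + g.natDegree = ℓ :=
    GBDim.rank_fromCols_circulant_add a b g hgdef hg
  exact ⟨h1, by rw [AbelianTwoBlock.rank_HZ]; exact h1⟩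

end GBDimensionProof

end Literature.InformationTheory.QuantumCodes
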